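import Summits.NavierStokesRegularity.NavierStokesRegularity.Theorems.WakeRatchetEternalViscousRateCircuitPumpAssembly
import Summits.NavierStokesRegularity.NavierStokesRegularity.Theorems.WakeRatchetEternalViscousRateCircuitPumpAction
import Summits.NavierStokesRegularity.NavierStokesRegularity.Theorems.WakeRatchetEternalViscousRate.Negative.EternalViscousRateFalseOfViscousBlockDSSWaves

/-!
# `WakeRatchet.EternalViscousRate` (stmt-NavierStokesRegularity-25647): a perpetual-pump witness KILLS THE INNER
# RATE STATEMENT at its own scale ratio, for every exponent `a > 1` — modulo the single remaining input (hbd)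

Final link of this session's chain (`…CircuitPumpClock` → `…Table` → `…Renorm` → `…FarPast` → `…Action` → `…Assembly`):
for ANY witness of the clauses of `PerpetualPump.CircuitPump` with period 1 (a cyclic-cancelling table `coeff`, a solution
`X` of the viscous circuit on `(-∞,0)` that is exactly self-similar, Type I and non-trivial) the uniform per-shell action
is now PROVED (`WakeRatchetCircuitPumpAction.action_of_typeI`), so GIVEN ONLY
  (hbd) every shell vector is bounded on `[-1/2, 0)` (= `CircuitPumpNegative.typeI_critical_bound`, a tree theorem whose
        module does not build on the farm at the time of writing — import it and this hypothesis disappears),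
the renormalised family `W` is an admissible eternal solution with covariant viscosity `1` of the pulled-back table at
`ε₀ = lam^{2/5} - 1`, uniformly bounded and block-self-similar, and therefore — by the landed lag-pinning kill criterion
`WakeRatchetViscDSS.not_rateContraction_of_viscBlockDSS` (p608789) — the conclusion of `EternalViscousRate` FAILS for this
`(ε₀, α, ν̂ = 1, W)` for EVERY `a > 1` (`not_rateContraction_of_pumpWitness`).  Since `PerpetualPumpCircuitPump.CircuitPump_proof`
provides such witnesses with `lam ↓ 1` on the seeded graded Toda table (`∈ InTableClass (2/ε(lam))`,
`WakeRatchetCircuitPumpTodaClass`), the crux ⟨25647⟩ can only hold with a spread-dependent threshold `εs(R) → 0`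
(`R = 2/ε(lam) → ∞`); the remaining formal steps to that Negative lemma are (hbd), the re-export of the m = 2 witness with
its explicit table from `PerpetualPumpCircuitPumpClockBox` (also unbuilt today) and zero-padding to `m = 4`.
HONEST LABEL: MODEL lattice ODEs only (Tao 2016 §4, §6.4); conditional on (hbd); no item is closed or refuted; nothing here
bears on the Navier–Stokes equations.
-/

set_option linter.dupNamespace false

noncomputable section

open scoped BigOperators
open Real Set Filter Topology MeasureTheory

namespace Summit.NavierStokesRegularity.NavierStokesRegularity.Theorems.WakeRatchetCircuitPumpKill

open Summit.NavierStokesRegularity.NavierStokesRegularity.Theorems.CircuitPumpNegative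
open Summit.NavierStokesRegularity.NavierStokesRegularity.Theorems.WakeRatchetCircuitPumpTable
open Summit.NavierStokesRegularity.NavierStokesRegularity.Theorems.WakeRatchetCircuitPumpAssembly
open Summit.NavierStokesRegularity.NavierStokesRegularity.Theorems.WakeRatchetCircuitPumpAction
open Summit.NavierStokesRegularity.NavierStokesRegularity.Theorems.WakeRatchetViscDSS
open Literature.Analysis.FluidPDE Literature.Analysis.FluidPDE.TaoCascade

variable {m : ℕ}

/-- **A perpetual-pump witness refutes the inner rate statement of `EternalViscousRate` at its own scale ratio, for
every `a > 1` (modulo (hbd)).**  See the module docstring.  Output: the scale parameter `ε₀` with `(1+ε₀)^{5/2} = lam`, the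
renormalised admissible eternal solution `W` with covariant viscosity `1` of the pulled-back table, its uniform bound, and
the failure of the tail-envelope contraction by `(1+ε₀)^{-a}`.
[cite: Tao2016AveragedNS, §4 Thm. 4.2 (statement shape), the viscous equation before it, §6.4; cell vocabulary (stmt-NavierStokesRegularity-25647)] -/
theorem not_rateContraction_of_pumpWitness {lam : ℝ} (hlam : 1 < lam)
    (coeff : Fin m → Fin m → Fin m → Option (Fin 3) → ℝ) (hcyc : IsCyc coeff) (X : Fin m → ℤ → ℝ → ℝ)
    (hode : SolvesODE lam coeff X) (hdss : IsDSS lam 1 X) (hTI : IsTypeI lam X) (hnt : IsNontrivial X)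
    (hbd : ∀ n : ℤ, ∃ P : ℝ, ∀ t : ℝ, -(1 / 2) ≤ t → t < 0 → ‖shellVec X n t‖ ≤ P) {a : ℝ} (ha : 1 < a) :
    ∃ (ε₀ : ℝ) (W : ℤ → ℝ → Em m), 0 < ε₀ ∧ (1 + ε₀) ^ ((5 : ℝ) / 2) = lam ∧
      IsEternalVisc ε₀ 1 (fun (i₁ i₂ i₃ : Fin m) (μ : ℤ × ℤ × ℤ) =>
        if μ = (0, 0, 0) then coeff i₁ i₂ i₃ none
        else if μ = (1, 0, 0) then coeff i₁ i₂ i₃ (some 0)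
        else if μ = (0, 1, 0) then coeff i₁ i₂ i₃ (some 1)
        else if μ = (0, 0, 1) then coeff i₁ i₂ i₃ (some 2) else 0) W ∧
      UniformBound W ∧
      ¬ ∀ (n : ℤ) (M : ℝ), (∀ σ : ℝ, ∑' k : ℕ, physEnergy ε₀ W (n + k) σ ≤ M) →
          ∀ σ : ℝ, ∑' k : ℕ, physEnergy ε₀ W (n + 1 + k) σ ≤ (1 + ε₀) ^ (-a) * M := by
  -- the action is a theorem; only (hbd) is assumed
  obtain ⟨M, hact⟩ := action_of_typeI hlam coeff X hode hTI
  obtain ⟨ε₀, W, hε, hlamε, hW, hU, hD, hne⟩ :=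
    viscousBlockDSS_of_pumpWitness hlam coeff X hode hdss hTI hnt hact hbd
  refine ⟨ε₀, W, hε, hlamε, hW, hU, ?_⟩
  obtain ⟨n₀, σ₀, hne₀⟩ := hne
  have hc := isCancellingCoeff_of_isCyc coeff hcyc
  have hD' : ∀ (n : ℤ) (σ : ℝ), W (n + (1 : ℕ)) σ = W n (σ - 2 * Real.log (1 + ε₀)) := by
    intro n σ
    simpa using hD n σ
  exact not_rateContraction_of_viscBlockDSS hε one_pos ha hc hW hU one_pos hD' hne₀

end Summit.NavierStokesRegularity.NavierStokesRegularity.Theorems.WakeRatchetCircuitPumpKill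

end
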